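import Mathlib

/-!
# `NoHeavyLowerTail` (crux stmt-CriticalPhenomena-4575), abstract sunflower cubic: EVALUATING NONNEGATIVE / ABSOLUTELY
# CONVERGENT MULTIVARIATE POWER-SERIES IDENTITIES AT A REAL POINT

Support file (seat `prim-ineq-prove-1` gen 46; `--supports stmt-CriticalPhenomena-4575`).  `import Mathlib` only; no `sorry`.
Memo: run/shared/lean/prim/prim-ineq-prove-1/FINDING-PAR-prove1-g46.md §2 (iv) (the analytic step from the formal theorem
(PAR) to the concavity / chord inequality of the real function `q ↦ F_𝒰[ψ^{K,q}]`).

For `f : MvPowerSeries ι ℚ` and a point `x : ι → ℝ` with `x ≥ 0` put `mono x β = ∏ i, x i ^ β i`,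
`AbsConv x f : Summable (β ↦ |f_β| · mono x β)` and `ev x f = ∑' β, f_β · mono x β`.
* `ev_add`, `ev_mul` / `AbsConv.mul` (Cauchy product over the antidiagonals of `ι →₀ ℕ`), `ev_prod`;
* `absConv_of_support_finite`, `ev_one`, `ev_one_sub_sum_X` (`ev (1 - ∑_{a∈B} X a) = 1 - ∑_{a∈B} x a`);
Part 2 (`…SunflowerSeriesEvalGeom`): the geometric series `(1 - ∑_{a∈B} X a)⁻¹` and the chord inequality.
-/

namespace Summit.CriticalPhenomena.PercolationContinuityZ3.Theorems.SunflowerPartition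

namespace SeriesEval

open MvPowerSeries Finset

variable {ι : Type*} [Fintype ι] [DecidableEq ι]

/-- The monomial `x^β = ∏ i, x i ^ β i`. [this work] -/
def mono (x : ι → ℝ) (β : ι →₀ ℕ) : ℝ := ∏ i, x i ^ β i

omit [DecidableEq ι] in
/-- `x^0 = 1`. [this work] -/
theorem mono_zero (x : ι → ℝ) : mono x 0 = 1 := by simp [mono]

omit [DecidableEq ι] in
/-- `x^(β+β') = x^β x^β'`. [this work] -/
theorem mono_add (x : ι → ℝ) (β β' : ι →₀ ℕ) : mono x (β + β') = mono x β * mono x β' := by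
  simp only [mono, Finsupp.coe_add, Pi.add_apply, pow_add, prod_mul_distrib]

omit [DecidableEq ι] in
/-- Monomials are nonnegative at nonnegative points. [this work] -/
theorem mono_nonneg {x : ι → ℝ} (hx : ∀ i, 0 ≤ x i) (β : ι →₀ ℕ) : 0 ≤ mono x β :=
  prod_nonneg fun i _ => pow_nonneg (hx i) _

/-- `x^(e_i) = x i`. [this work] -/
theorem mono_single (x : ι → ℝ) (i : ι) : mono x (Finsupp.single i 1) = x i := by
  unfold mono
  rw [← Finset.prod_erase_mul _ _ (mem_univ i)]
  rw [Finsupp.single_eq_same, pow_one]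
  rw [Finset.prod_eq_one, one_mul]
  intro j hj
  rw [Finsupp.single_eq_of_ne (ne_of_mem_erase hj), pow_zero]

/-- The term family of the evaluation of `f` at `x`. [this work] -/
def term (x : ι → ℝ) (f : MvPowerSeries ι ℚ) (β : ι →₀ ℕ) : ℝ := ((coeff β f : ℚ) : ℝ) * mono x β

/-- Absolute convergence of `f` at the point `x`. [this work] -/
def AbsConv (x : ι → ℝ) (f : MvPowerSeries ι ℚ) : Prop := Summable fun β => |((coeff β f : ℚ) : ℝ)| * mono x β

/-- The value of `f` at `x` (as a `tsum`; meaningful under `AbsConv`). [this work] -/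
noncomputable def ev (x : ι → ℝ) (f : MvPowerSeries ι ℚ) : ℝ := ∑' β, term x f β

variable {x : ι → ℝ}

omit [DecidableEq ι] in
/-- The norm of a term. [this work] -/
theorem norm_term (hx : ∀ i, 0 ≤ x i) (f : MvPowerSeries ι ℚ) (β : ι →₀ ℕ) :
    ‖term x f β‖ = |((coeff β f : ℚ) : ℝ)| * mono x β := by
  rw [term, Real.norm_eq_abs, abs_mul, abs_of_nonneg (mono_nonneg hx β)]

omit [DecidableEq ι] in
/-- Absolute convergence gives summability of the term family. [this work] -/
theorem AbsConv.summable (hx : ∀ i, 0 ≤ x i) {f : MvPowerSeries ι ℚ} (hf : AbsConv x f) : Summable (term x f) := by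
  refine Summable.of_norm ?_
  have hf' : Summable (fun β => |((coeff β f : ℚ) : ℝ)| * mono x β) := hf
  exact hf'.congr fun β => (norm_term hx f β).symm

omit [DecidableEq ι] in
/-- Summability of the norms of the terms. [this work] -/
theorem AbsConv.summable_norm (hx : ∀ i, 0 ≤ x i) {f : MvPowerSeries ι ℚ} (hf : AbsConv x f) :
    Summable fun β => ‖term x f β‖ := by
  have hf' : Summable (fun β => |((coeff β f : ℚ) : ℝ)| * mono x β) := hf
  exact hf'.congr fun β => (norm_term hx f β).symm

omit [DecidableEq ι] in
/-- A series with finitely many nonzero coefficients converges absolutely everywhere. [this work] -/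
theorem absConv_of_support_finite (f : MvPowerSeries ι ℚ) (s : Finset (ι →₀ ℕ)) (hs : ∀ β ∉ s, coeff β f = 0) :
    AbsConv x f := by
  refine summable_of_ne_finset_zero (s := s) (f := fun β => |((coeff β f : ℚ) : ℝ)| * mono x β) fun β hβ => ?_
  rw [hs β hβ]; simp

omit [DecidableEq ι] in
/-- Evaluation of a series with finitely many nonzero coefficients. [this work] -/
theorem ev_of_support_finite (f : MvPowerSeries ι ℚ) (s : Finset (ι →₀ ℕ)) (hs : ∀ β ∉ s, coeff β f = 0) :
    ev x f = ∑ β ∈ s, term x f β := by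
  refine tsum_eq_sum fun β hβ => ?_
  rw [term, hs β hβ]; simp

omit [DecidableEq ι] in
/-- `AbsConv` is closed under addition. [this work] -/
theorem AbsConv.add {f g : MvPowerSeries ι ℚ} (hx : ∀ i, 0 ≤ x i) (hf : AbsConv x f) (hg : AbsConv x g) :
    AbsConv x (f + g) := by
  refine Summable.of_nonneg_of_le (fun β => mul_nonneg (abs_nonneg _) (mono_nonneg hx β)) (fun β => ?_)
    (Summable.add hf hg)
  rw [map_add, Rat.cast_add, ← add_mul]
  exact mul_le_mul_of_nonneg_right (abs_add_le _ _) (mono_nonneg hx β)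

omit [DecidableEq ι] in
/-- `AbsConv` is closed under negation. [this work] -/
theorem AbsConv.neg {f : MvPowerSeries ι ℚ} (hf : AbsConv x f) : AbsConv x (-f) := by
  have hf' : Summable (fun β => |((coeff β f : ℚ) : ℝ)| * mono x β) := hf
  show Summable (fun β => |((coeff β (-f) : ℚ) : ℝ)| * mono x β)
  simpa only [map_neg, Rat.cast_neg, abs_neg] using hf'

omit [DecidableEq ι] in
/-- `AbsConv` is closed under subtraction. [this work] -/
theorem AbsConv.sub {f g : MvPowerSeries ι ℚ} (hx : ∀ i, 0 ≤ x i) (hf : AbsConv x f) (hg : AbsConv x g) :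
    AbsConv x (f - g) := by
  rw [sub_eq_add_neg]; exact hf.add hx hg.neg

omit [DecidableEq ι] in
/-- `ev` is additive on absolutely convergent series. [this work] -/
theorem ev_add {f g : MvPowerSeries ι ℚ} (hx : ∀ i, 0 ≤ x i) (hf : AbsConv x f) (hg : AbsConv x g) :
    ev x (f + g) = ev x f + ev x g := by
  unfold ev
  rw [← (hf.summable hx).tsum_add (hg.summable hx)]
  refine tsum_congr fun β => ?_
  simp only [term, map_add, Rat.cast_add, add_mul]

omit [DecidableEq ι] in
/-- `ev` commutes with negation. [this work] -/
theorem ev_neg (f : MvPowerSeries ι ℚ) : ev x (-f) = -ev x f := by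
  unfold ev
  rw [← tsum_neg]
  refine tsum_congr fun β => ?_
  simp only [term, map_neg, Rat.cast_neg, neg_mul]

omit [DecidableEq ι] in
/-- `ev` is subtractive on absolutely convergent series. [this work] -/
theorem ev_sub {f g : MvPowerSeries ι ℚ} (hx : ∀ i, 0 ≤ x i) (hf : AbsConv x f) (hg : AbsConv x g) :
    ev x (f - g) = ev x f - ev x g := by
  rw [sub_eq_add_neg, ev_add hx hf hg.neg, ev_neg, ← sub_eq_add_neg]

omit [DecidableEq ι] in
/-- `ev 1 = 1`. [this work] -/
theorem ev_one : ev x (1 : MvPowerSeries ι ℚ) = 1 := by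
  classical
  rw [ev_of_support_finite 1 {0} (fun β hβ => by rw [coeff_one, if_neg (by simpa using hβ)])]
  simp [term, coeff_one, mono_zero]

omit [DecidableEq ι] in
/-- `1` converges absolutely. [this work] -/
theorem absConv_one : AbsConv x (1 : MvPowerSeries ι ℚ) := by
  classical
  exact absConv_of_support_finite 1 {0} (fun β hβ => by rw [coeff_one, if_neg (by simpa using hβ)])

/-- `X a` converges absolutely everywhere. [this work] -/
theorem absConv_X (a : ι) : AbsConv x (X a : MvPowerSeries ι ℚ) :=
  absConv_of_support_finite _ {Finsupp.single a 1} fun β hβ => by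
    rw [coeff_X, if_neg (by simpa using hβ)]

/-- `ev (X a) = x a`. [this work] -/
theorem ev_X (a : ι) : ev x (X a : MvPowerSeries ι ℚ) = x a := by
  rw [ev_of_support_finite _ {Finsupp.single a 1} fun β hβ => by rw [coeff_X, if_neg (by simpa using hβ)]]
  simp [term, coeff_X, mono_single]

omit [DecidableEq ι] in
/-- `AbsConv` is closed under finite sums. [this work] -/
theorem absConv_sum (hx : ∀ i, 0 ≤ x i) {κ : Type*} (s : Finset κ) (f : κ → MvPowerSeries ι ℚ)
    (hf : ∀ k ∈ s, AbsConv x (f k)) : AbsConv x (∑ k ∈ s, f k) := by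
  classical
  induction s using Finset.induction_on with
  | empty => rw [sum_empty]; exact absConv_of_support_finite 0 ∅ fun β _ => by simp
  | insert k s hk ih =>
    rw [sum_insert hk]
    exact (hf k (mem_insert_self k s)).add hx (ih fun j hj => hf j (mem_insert_of_mem hj))

omit [DecidableEq ι] in
/-- `ev` is additive over finite sums of absolutely convergent series. [this work] -/
theorem ev_sum (hx : ∀ i, 0 ≤ x i) {κ : Type*} (s : Finset κ) (f : κ → MvPowerSeries ι ℚ)
    (hf : ∀ k ∈ s, AbsConv x (f k)) : ev x (∑ k ∈ s, f k) = ∑ k ∈ s, ev x (f k) := by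
  classical
  induction s using Finset.induction_on with
  | empty => rw [sum_empty, sum_empty, ev_of_support_finite 0 ∅ fun β _ => by simp]; simp
  | insert k s hk ih =>
    rw [sum_insert hk, sum_insert hk, ev_add hx (hf k (mem_insert_self k s))
      (absConv_sum hx s f fun j hj => hf j (mem_insert_of_mem hj)), ih fun j hj => hf j (mem_insert_of_mem hj)]

/-- `1 - ∑_{a∈B} X a` converges absolutely. [this work] -/
theorem absConv_one_sub_sum_X (hx : ∀ i, 0 ≤ x i) (B : Finset ι) :
    AbsConv x (1 - ∑ a ∈ B, X a : MvPowerSeries ι ℚ) :=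
  absConv_one.sub hx (absConv_sum hx B _ fun a _ => absConv_X a)

/-- `ev (1 - ∑_{a∈B} X a) = 1 - ∑_{a∈B} x a`. [this work] -/
theorem ev_one_sub_sum_X (hx : ∀ i, 0 ≤ x i) (B : Finset ι) :
    ev x (1 - ∑ a ∈ B, X a : MvPowerSeries ι ℚ) = 1 - ∑ a ∈ B, x a := by
  rw [ev_sub hx absConv_one (absConv_sum hx B _ fun a _ => absConv_X a), ev_one,
    ev_sum hx B _ fun a _ => absConv_X a]
  simp only [ev_X]

/-! ## Products (Cauchy product over the antidiagonals of `ι →₀ ℕ`) -/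

/-- The Cauchy-product rearrangement of the terms of `f * g`. [this work] -/
theorem sum_antidiagonal_term_mul (f g : MvPowerSeries ι ℚ) (n : ι →₀ ℕ) :
    ∑ kl ∈ antidiagonal n, term x f kl.1 * term x g kl.2 = term x (f * g) n := by
  rw [term, coeff_mul, Rat.cast_sum, sum_mul]
  refine sum_congr rfl fun kl hkl => ?_
  have hn : kl.1 + kl.2 = n := Finset.HasAntidiagonal.mem_antidiagonal.mp hkl
  rw [term, term, Rat.cast_mul, ← hn, mono_add]; ring

omit [DecidableEq ι] in
/-- The product family of the terms of two absolutely convergent series is summable (in norm). [this work] -/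
theorem summable_norm_term_prod (hx : ∀ i, 0 ≤ x i) {f g : MvPowerSeries ι ℚ} (hf : AbsConv x f) (hg : AbsConv x g) :
    Summable fun z : (ι →₀ ℕ) × (ι →₀ ℕ) => ‖term x f z.1‖ * ‖term x g z.2‖ :=
  Summable.mul_of_nonneg (hf.summable_norm hx) (hg.summable_norm hx) (fun _ => norm_nonneg _)
    (fun _ => norm_nonneg _)

omit [DecidableEq ι] in
/-- The product family of the terms is summable. [this work] -/
theorem summable_term_prod (hx : ∀ i, 0 ≤ x i) {f g : MvPowerSeries ι ℚ} (hf : AbsConv x f) (hg : AbsConv x g) :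
    Summable fun z : (ι →₀ ℕ) × (ι →₀ ℕ) => term x f z.1 * term x g z.2 := by
  refine Summable.of_norm ?_
  exact (summable_norm_term_prod hx hf hg).congr fun z => (norm_mul _ _).symm

/-- `AbsConv` is closed under products. [this work] -/
theorem AbsConv.mul (hx : ∀ i, 0 ≤ x i) {f g : MvPowerSeries ι ℚ} (hf : AbsConv x f) (hg : AbsConv x g) :
    AbsConv x (f * g) := by
  have h2 : Summable fun n : ι →₀ ℕ => ∑ kl ∈ antidiagonal n, ‖term x f kl.1‖ * ‖term x g kl.2‖ :=
    summable_sum_mul_antidiagonal_of_summable_mul (f := fun k => ‖term x f k‖) (g := fun l => ‖term x g l‖)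
      (summable_norm_term_prod hx hf hg)
  have hle : ∀ n : ι →₀ ℕ, |((coeff n (f * g) : ℚ) : ℝ)| * mono x n ≤
      ∑ kl ∈ antidiagonal n, ‖term x f kl.1‖ * ‖term x g kl.2‖ := by
    intro n
    rw [← norm_term hx, ← sum_antidiagonal_term_mul f g n]
    exact (norm_sum_le _ _).trans (sum_le_sum fun kl _ => norm_mul_le _ _)
  exact Summable.of_nonneg_of_le (fun β => mul_nonneg (abs_nonneg _) (mono_nonneg hx β)) hle h2

/-- `ev` is multiplicative on absolutely convergent series. [this work] -/
theorem ev_mul (hx : ∀ i, 0 ≤ x i) {f g : MvPowerSeries ι ℚ} (hf : AbsConv x f) (hg : AbsConv x g) :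
    ev x (f * g) = ev x f * ev x g := by
  unfold ev
  rw [(hf.summable hx).tsum_mul_tsum_eq_tsum_sum_antidiagonal (hg.summable hx) (summable_term_prod hx hf hg)]
  exact (tsum_congr (sum_antidiagonal_term_mul f g)).symm

/-- `ev` is multiplicative on finite products of absolutely convergent series. [this work] -/
theorem ev_prod (hx : ∀ i, 0 ≤ x i) {κ : Type*} (s : Finset κ) (f : κ → MvPowerSeries ι ℚ)
    (hf : ∀ k ∈ s, AbsConv x (f k)) :
    AbsConv x (∏ k ∈ s, f k) ∧ ev x (∏ k ∈ s, f k) = ∏ k ∈ s, ev x (f k) := by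
  classical
  induction s using Finset.induction_on with
  | empty => exact ⟨by simpa using absConv_one, by simp [ev_one]⟩
  | insert k s hk ih =>
    have ih' := ih fun j hj => hf j (mem_insert_of_mem hj)
    have hk' := hf k (mem_insert_self k s)
    rw [prod_insert hk, prod_insert hk]
    exact ⟨hk'.mul hx ih'.1, by rw [ev_mul hx hk' ih'.1, ih'.2]⟩

end SeriesEval

end Summit.CriticalPhenomena.PercolationContinuityZ3.Theorems.SunflowerPartition
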